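import Summits.AtomisticToContinuum.BoseEinsteinCondensation.Theorems.BECCutLineWeakDisorderWitnessTransferPairBrownian
import Literature.MathematicalPhysics.QuantumManyBody.BoseGasHardSet
import Literature.Probability.Process.BrownianSupTail
import HarnessLib

/-!
# Route BECCutLineWeakDisorder — `WitnessTransfer`, hard-sphere vanishing II:
# entering the open core kills the Feynman–Kac weight

Support file (does not close the item) for item stmt-AtomisticToContinuum-14978
(`Summit.AtomisticToContinuum.BoseEinsteinCondensation.Theses.BECCutLineWeakDisorder`, decl
`WitnessTransfer`), stub `stub_vanish_hardSphere` (hard-sphere case of (E2) `stub_vanish`) of line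
`Sketch`. For a pair potential with a HARD CORE of radius `a` (`v = ⊤` on `[0, a)`):

* `pathAction_eq_top_of_dist_lt`, `fkWeight_eq_zero_of_dist_lt` — if two world-lines are at
  distance `< a` at some time `s₀ ∈ [0, T)`, then (path continuity) they stay so on a nontrivial
  time interval, the interaction action is `+∞` and the Feynman–Kac weight vanishes;
  `fkSemigroup_eq_zero_of_dist_lt` — hence `(e^{-TH}1)(X) = 0` whenever `|xᵢ - xⱼ| < a`;
* `fkSemigroup_one_le_measure` — `(e^{-TH}1)(X) ≤ P(E)` for any event `E` off which the weight
  vanishes;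
* `dist_worldLine_lt_of_radial` — deterministic geometry of core entry: if the radial component
  of the relative displacement is `≤ -θ` while all coordinates are `< c'` in absolute value, and
  `|y|² - 4|y|θ + 24 c'² ≤ a²` (`y = xᵢ - xⱼ`), the pair is inside the open core;
* `fkSemigroup_le_of_near_core` — **the union bound**: for `|y| ≥ a` and parameters
  `0 < θ ≤ √τ`, `τ < T`, `τ < c'²` with the above geometric constraint,
  `(e^{-TH}1)(X) ≤ 2√(θ/√τ) + 6 · 2τ²/(c'² - τ)²` — the small-ball bound for the radial Brownian
  motion (`measure_forall_coordComb_lt_le`) plus the running-maximum tails of the six Brownian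
  coordinates of the pair (`measure_exists_le_abs_brownian_le`). This is the regularity of the
  hard sphere for the `6`-dimensional pair motion, uniformly in the starting point
  (Chung–Zhao (1995), §1.4 and Thm 3.17 (iv)).

## References

* K. L. Chung, Z. Zhao, *From Brownian Motion to Schrödinger's Equation* (1995), §1.4, Thm 3.17.
  [ChungZhao1995]
* D. Revuz, M. Yor, *Continuous Martingales and Brownian Motion* (1999), Ch. II (1.7).
  [RevuzYor1999]
-/

noncomputable section

open MeasureTheory ProbabilityTheory Filter Set Metric
open scoped ENNReal NNReal Topology

namespace Summit.AtomisticToContinuum.BoseEinsteinCondensation.Theorems.CutLineWitness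

open Literature.MathematicalPhysics.QuantumManyBody.BoseGas
open Literature.Probability.Process

/-! ### Entering the open core kills the weight -/

/-- **Inside the hard core the action is infinite.** If `v = ⊤` on `[0, a)` and two world-lines
are at distance `< a` at a time `s₀ ∈ [0, T)`, then by path continuity they remain so on a
nontrivial interval `(s₀, s₁) ⊆ (0, T]`, on which the interaction is `⊤`; hence
`∫₀ᵀ ∑ v(|Bⁱ_s - Bʲ_s|) ds = ⊤`. [folklore] -/
theorem pathAction_eq_top_of_dist_lt {N : ℕ} {v : ℝ → ℝ≥0∞} {a : ℝ}
    (hcore : ∀ r : ℝ, 0 ≤ r → r < a → v r = ⊤) {T : ℝ} (X : Config N) (ω : PathSpace N)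
    {i j : Fin N} (hij : i ≠ j) {s₀ : ℝ} (hs₀ : 0 ≤ s₀) (hs₀T : s₀ < T)
    (hlt : dist (worldLine X ω s₀.toNNReal i) (worldLine X ω s₀.toNNReal j) < a) :
    pathAction v T X ω = ⊤ := by
  have hcont : Continuous fun s : ℝ =>
      dist (worldLine X ω s.toNNReal i) (worldLine X ω s.toNNReal j) :=
    ((continuous_apply i).comp (continuous_worldLine_toNNReal X ω)).dist
      ((continuous_apply j).comp (continuous_worldLine_toNNReal X ω))
  have hopen : IsOpen {s : ℝ |
      dist (worldLine X ω s.toNNReal i) (worldLine X ω s.toNNReal j) < a} :=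
    isOpen_lt hcont continuous_const
  obtain ⟨δ, hδ, hball⟩ := Metric.isOpen_iff.1 hopen s₀ hlt
  set s₁ : ℝ := min (s₀ + δ) T with hs₁
  have hs₀₁ : s₀ < s₁ := lt_min (by linarith) hs₀T
  have htop : ∀ s ∈ Ioo s₀ s₁, interaction v (worldLine X ω s.toNNReal) = ⊤ := by
    intro s hs
    have hsball : s ∈ Metric.ball s₀ δ := by
      rw [Metric.mem_ball, Real.dist_eq, abs_lt]
      constructor <;> linarith [hs.1, hs.2, min_le_left (s₀ + δ) T]
    have hsa : dist (worldLine X ω s.toNNReal i) (worldLine X ω s.toNNReal j) < a := hball hsball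
    refine eq_top_iff.2 ?_
    calc (⊤ : ℝ≥0∞) = v (dist (worldLine X ω s.toNNReal i) (worldLine X ω s.toNNReal j)) :=
          (hcore _ dist_nonneg hsa).symm
      _ ≤ interaction v (worldLine X ω s.toNNReal) := apply_dist_le_interaction v _ hij
  unfold pathAction
  refine eq_top_iff.2 ?_
  calc (⊤ : ℝ≥0∞) = ∫⁻ _ in Ioo s₀ s₁, (⊤ : ℝ≥0∞) := by
        rw [setLIntegral_const, Real.volume_Ioo, ENNReal.top_mul]
        exact (ENNReal.ofReal_pos.2 (by linarith)).ne'
    _ = ∫⁻ s in Ioo s₀ s₁, interaction v (worldLine X ω s.toNNReal) :=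
        setLIntegral_congr_fun measurableSet_Ioo fun s hs => (htop s hs).symm
    _ ≤ ∫⁻ s in Ioc 0 T, interaction v (worldLine X ω s.toNNReal) :=
        lintegral_mono_set fun s hs => ⟨hs₀.trans_lt hs.1, hs.2.le.trans (min_le_right _ _)⟩

/-- **Entering the open core kills the Feynman–Kac weight**: under the hypotheses of
`pathAction_eq_top_of_dist_lt`, `fkWeight v L T X ω = 0` (`e^{-∞} = 0`). [folklore] -/
theorem fkWeight_eq_zero_of_dist_lt {N : ℕ} {v : ℝ → ℝ≥0∞} {a : ℝ}
    (hcore : ∀ r : ℝ, 0 ≤ r → r < a → v r = ⊤) (L : ℝ) {T : ℝ} (X : Config N) (ω : PathSpace N)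
    {i j : Fin N} (hij : i ≠ j) {s₀ : ℝ} (hs₀ : 0 ≤ s₀) (hs₀T : s₀ < T)
    (hlt : dist (worldLine X ω s₀.toNNReal i) (worldLine X ω s₀.toNNReal j) < a) :
    fkWeight v L T X ω = 0 := by
  have hpa := pathAction_eq_top_of_dist_lt hcore X ω hij hs₀ hs₀T hlt
  unfold fkWeight
  by_cases hω : ω ∈ survives L T X
  · rw [indicator_of_mem hω, hpa, expNeg_top]
  · rw [indicator_of_notMem hω]

/-- **A pair starting inside the open core contributes nothing**: if `|xᵢ - xⱼ| < a` then
`(e^{-TH} g)(X) = 0` for every `T > 0` (the case `s₀ = 0` of `fkWeight_eq_zero_of_dist_lt`).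
[folklore] -/
theorem fkSemigroup_eq_zero_of_dist_lt {N : ℕ} {v : ℝ → ℝ≥0∞} {a : ℝ}
    (hcore : ∀ r : ℝ, 0 ≤ r → r < a → v r = ⊤) (L : ℝ) {T : ℝ} (hT : 0 < T)
    (g : Config N → ℝ≥0∞) {X : Config N} {i j : Fin N} (hij : i ≠ j)
    (hlt : dist (X i) (X j) < a) : fkSemigroup v L T g X = 0 := by
  have h : ∀ ω, fkWeight v L T X ω = 0 := fun ω => by
    refine fkWeight_eq_zero_of_dist_lt hcore L X ω hij le_rfl hT ?_
    rw [Real.toNNReal_zero, worldLine_zero]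
    exact hlt
  simp [fkSemigroup, h]

/-- `(e^{-TH}1)(X) ≤ P(E)` for every event `E` off which the Feynman–Kac weight vanishes (weights
are `≤ 1`; no measurability of `E` needed). [folklore] -/
theorem fkSemigroup_one_le_measure {N : ℕ} (v : ℝ → ℝ≥0∞) (L T : ℝ) (X : Config N)
    {E : Set (PathSpace N)} (hE : ∀ ω, ω ∉ E → fkWeight v L T X ω = 0) :
    fkSemigroup v L T (fun _ => (1 : ℝ≥0∞)) X ≤ wienerPaths N E := by
  unfold fkSemigroup
  refine (lintegral_mono fun ω => ?_).trans (lintegral_indicator_one_le E)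
  by_cases hω : ω ∈ E
  · rw [indicator_of_mem hω, Pi.one_apply, mul_one]
    exact fkWeight_le_one v L T X ω
  · rw [hE ω hω, zero_mul]
    exact bot_le

/-! ### Geometry of core entry along the radial direction -/

/-- **Core entry, deterministic part.** Write `y = xᵢ - xⱼ` and `d_l = b_r(ω i l) - b_r(ω j l)`,
so that `Bⁱ_r - Bʲ_r = y + √2 d` and `|Bⁱ_r - Bʲ_r|² = |y|² + 2√2 ∑ y_l d_l + 2 ∑ d_l²`. If the
radial component satisfies `∑ y_l d_l ≤ -√2 |y| θ`, every `|b_r(ω i l)|, |b_r(ω j l)| < c'`, and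
`|y|² - 4|y|θ + 24 c'² ≤ a²`, then `|Bⁱ_r - Bʲ_r| < a`. [folklore] -/
theorem dist_worldLine_lt_of_radial {N : ℕ} (X : Config N) (ω : PathSpace N) {i j : Fin N}
    (r : ℝ≥0) {a θ c' : ℝ} (ha : 0 < a)
    (hU : ∑ l, (X i - X j) l * (brownian r (ω i l) - brownian r (ω j l)) ≤
      -(Real.sqrt 2 * ‖X i - X j‖ * θ))
    (hb : ∀ l, |brownian r (ω i l)| < c' ∧ |brownian r (ω j l)| < c')
    (hgeom : ‖X i - X j‖ ^ 2 - 4 * ‖X i - X j‖ * θ + 24 * c' ^ 2 ≤ a ^ 2) :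
    dist (worldLine X ω r i) (worldLine X ω r j) < a := by
  set y : Space := X i - X j with hy
  set d : Fin 3 → ℝ := fun l => brownian r (ω i l) - brownian r (ω j l) with hd
  have hs : Real.sqrt 2 ^ 2 = 2 := Real.sq_sqrt (by norm_num)
  have hcoord : ∀ l, (worldLine X ω r i - worldLine X ω r j) l = y l + Real.sqrt 2 * d l := by
    intro l
    simp only [hy, hd, PiLp.sub_apply, worldLine_apply_apply]
    ring
  have hnorm : dist (worldLine X ω r i) (worldLine X ω r j) ^ 2 =
      ‖y‖ ^ 2 + 2 * Real.sqrt 2 * (∑ l, y l * d l) + 2 * ∑ l, d l ^ 2 := by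
    rw [dist_eq_norm, EuclideanSpace.real_norm_sq_eq, EuclideanSpace.real_norm_sq_eq]
    simp only [hcoord, Fin.sum_univ_three]
    linear_combination (d 0 ^ 2 + d 1 ^ 2 + d 2 ^ 2) * hs
  have hd2 : ∀ l, d l ^ 2 < 4 * c' ^ 2 := by
    intro l
    have habs : |d l| < 2 * c' := by
      calc |d l| ≤ |brownian r (ω i l)| + |brownian r (ω j l)| := abs_sub _ _
        _ < c' + c' := add_lt_add (hb l).1 (hb l).2
        _ = 2 * c' := by ring
    have h0 : 0 ≤ |d l| := abs_nonneg _
    nlinarith [sq_abs (d l)]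
  have hsum : ∑ l, d l ^ 2 < 12 * c' ^ 2 := by
    simp only [Fin.sum_univ_three]
    linarith [hd2 0, hd2 1, hd2 2]
  have hcross : 2 * Real.sqrt 2 * (∑ l, y l * d l) ≤ -(4 * ‖y‖ * θ) := by
    have h := mul_le_mul_of_nonneg_left hU (by positivity : (0 : ℝ) ≤ 2 * Real.sqrt 2)
    calc 2 * Real.sqrt 2 * (∑ l, y l * d l)
        ≤ 2 * Real.sqrt 2 * (-(Real.sqrt 2 * ‖y‖ * θ)) := h
      _ = -(2 * Real.sqrt 2 ^ 2 * ‖y‖ * θ) := by ring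
      _ = -(4 * ‖y‖ * θ) := by rw [hs]; ring
  have hsq : dist (worldLine X ω r i) (worldLine X ω r j) ^ 2 < a ^ 2 := by
    rw [hnorm]
    linarith
  exact lt_of_pow_lt_pow_left₀ 2 ha.le hsq

/-- The normalised radial coefficient vector of the pair `(i, j)` along `y`:
`c_{(m,l)} = y_l (δ_{mi} - δ_{mj}) / (√2 |y|)` has `∑ c² = 1` (`i ≠ j`, `y ≠ 0`). [folklore] -/
theorem sum_sq_radialCoeff {N : ℕ} {i j : Fin N} (hij : i ≠ j) {y : Space} (hy : 0 < ‖y‖) :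
    ∑ p : Fin N × Fin 3, (y p.2 / (Real.sqrt 2 * ‖y‖) *
      ((if p.1 = i then 1 else 0) - (if p.1 = j then 1 else 0))) ^ 2 = 1 := by
  have hs : Real.sqrt 2 ^ 2 = 2 := Real.sq_sqrt (by norm_num)
  have hδ : ∀ m : Fin N, ((if m = i then (1 : ℝ) else 0) - (if m = j then 1 else 0)) ^ 2 =
      (if m = i then 1 else 0) + (if m = j then 1 else 0) := by
    intro m
    by_cases hmi : m = i
    · subst hmi
      simp [hij]
    · by_cases hmj : m = j <;> simp [hmi, hmj, hij.symm]
  rw [Fintype.sum_prod_type, Finset.sum_comm]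
  simp only [mul_pow, hδ, mul_add, Finset.sum_add_distrib, mul_ite, mul_one, mul_zero,
    Finset.sum_ite_eq', Finset.mem_univ, if_true]
  have h1 : ∑ l : Fin 3, (y l / (Real.sqrt 2 * ‖y‖)) ^ 2 = 1 / 2 := by
    simp_rw [div_pow, mul_pow, hs]
    rw [← Finset.sum_div, ← EuclideanSpace.real_norm_sq_eq]
    field_simp
  rw [h1]
  norm_num

/-- The linear combination with the radial coefficients is the (normalised) radial component
`∑_l y_l (b i l - b j l) / (√2 |y|)`. [folklore] -/
theorem sum_radialCoeff_mul {N : ℕ} (i j : Fin N) (y : Space) (b : Fin N → Fin 3 → ℝ) :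
    ∑ p : Fin N × Fin 3, (y p.2 / (Real.sqrt 2 * ‖y‖) *
      ((if p.1 = i then 1 else 0) - (if p.1 = j then 1 else 0))) * b p.1 p.2 =
      (∑ l, y l * (b i l - b j l)) / (Real.sqrt 2 * ‖y‖) := by
  rw [Fintype.sum_prod_type, Finset.sum_comm]
  simp only [mul_sub, sub_mul, mul_ite, mul_one, mul_zero, ite_mul, zero_mul,
    Finset.sum_sub_distrib, Finset.sum_ite_eq', Finset.mem_univ, if_true]
  rw [sub_div, Finset.sum_div, Finset.sum_div]
  congr 1 <;> exact Finset.sum_congr rfl fun l _ => by ring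

/-! ### The union bound near the core -/

/-- **Regularity of the hard sphere for the pair motion, quantitative and uniform in the starting
point.** Let `v = ⊤` on `[0, a)`, `i ≠ j`, `y = xᵢ - xⱼ` with `|y| ≥ a`, and parameters
`0 < θ ≤ √τ`, `0 < τ < T`, `τ < c'²` with `|y|² - 4|y|θ + 24c'² ≤ a²`. Off the union of the
events `{∀ r ≤ τ, -U_r < θ}` (`U` the radial Brownian motion of the pair) and
`{∃ r ≤ τ, |b_r(ω m l)| ≥ c'}` (`m ∈ {i, j}`, `l ≤ 3`) the pair enters the open core before time
`τ < T` (`dist_worldLine_lt_of_radial`) and the weight dies (`fkWeight_eq_zero_of_dist_lt`); so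
`(e^{-TH}1)(X) ≤ 2√(θ/√τ) + 6 · 2τ²/(c'² - τ)²` by the small-ball bound for `-U`
(`measure_forall_coordComb_lt_le`) and the running-maximum tail of each coordinate
(`measure_exists_le_abs_brownian_le`). [cite: ChungZhao1995, Thm 3.17] -/
theorem fkSemigroup_le_of_near_core {N : ℕ} {v : ℝ → ℝ≥0∞} {a : ℝ} (ha : 0 < a)
    (hcore : ∀ r : ℝ, 0 ≤ r → r < a → v r = ⊤) (L : ℝ) {T : ℝ} (X : Config N) {i j : Fin N}
    (hij : i ≠ j) {θ c' : ℝ} {τ : ℝ≥0} (hθ : 0 < θ) (hc' : 0 < c') (hτ : 0 < τ)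
    (hτT : (τ : ℝ) < T) (hθτ : θ ≤ Real.sqrt τ) (hτc : (τ : ℝ) < c' ^ 2)
    (hy : a ≤ ‖X i - X j‖)
    (hgeom : ‖X i - X j‖ ^ 2 - 4 * ‖X i - X j‖ * θ + 24 * c' ^ 2 ≤ a ^ 2) :
    fkSemigroup v L T (fun _ => (1 : ℝ≥0∞)) X ≤
      ENNReal.ofReal (2 * Real.sqrt (θ / Real.sqrt τ)) +
        6 * ENNReal.ofReal (2 * (τ : ℝ) ^ 2 / (c' ^ 2 - τ) ^ 2) := by
  set y : Space := X i - X j with hydef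
  have hy0 : 0 < ‖y‖ := ha.trans_le hy
  have hk : 0 < Real.sqrt 2 * ‖y‖ := by positivity
  -- the radial coefficient vector and the events
  set c : Fin N × Fin 3 → ℝ := fun p => y p.2 / (Real.sqrt 2 * ‖y‖) *
    ((if p.1 = i then 1 else 0) - (if p.1 = j then 1 else 0)) with hc
  set E₁ : Set (PathSpace N) :=
    {ω | ∀ r ≤ τ, ∑ p, (fun p => -c p) p * brownian r (ω p.1 p.2) < θ} with hE₁
  set A : Set (ℝ≥0 → ℝ) := {η | ∃ r ≤ τ, c' ≤ |brownian r η|} with hA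
  set E₂ : Fin N → Fin 3 → Set (PathSpace N) :=
    fun m l => (fun ω : PathSpace N => ω m l) ⁻¹' A with hE₂
  -- off the bad event the pair enters the core before `τ`, and the weight dies
  have hkill : ∀ ω, ω ∉ E₁ ∪ ((⋃ l, E₂ i l) ∪ ⋃ l, E₂ j l) → fkWeight v L T X ω = 0 := by
    intro ω hω
    simp only [mem_union, mem_iUnion, not_or, not_exists] at hω
    obtain ⟨h1, h2i, h2j⟩ := hω
    simp only [hE₁, mem_setOf_eq, not_forall, not_lt, exists_prop] at h1
    obtain ⟨r, hr, hθr⟩ := h1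
    have hb : ∀ l, |brownian r (ω i l)| < c' ∧ |brownian r (ω j l)| < c' := by
      intro l
      have hi := h2i l
      have hj := h2j l
      simp only [hE₂, hA, mem_preimage, mem_setOf_eq, not_exists, not_and, not_le] at hi hj
      exact ⟨hi r hr, hj r hr⟩
    have hsum : ∑ p, (fun p => -c p) p * brownian r (ω p.1 p.2) =
        -((∑ l, y l * (brownian r (ω i l) - brownian r (ω j l))) / (Real.sqrt 2 * ‖y‖)) := by
      rw [← sum_radialCoeff_mul i j y (fun m l => brownian r (ω m l)), ← Finset.sum_neg_distrib]
      refine Finset.sum_congr rfl fun p _ => ?_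
      simp only [hc]
      ring
    rw [hsum] at hθr
    have hU : ∑ l, y l * (brownian r (ω i l) - brownian r (ω j l)) ≤
        -(Real.sqrt 2 * ‖y‖ * θ) := by
      have h1 : (∑ l, y l * (brownian r (ω i l) - brownian r (ω j l))) / (Real.sqrt 2 * ‖y‖) ≤
          -θ := by linarith
      rw [div_le_iff₀ hk] at h1
      linarith
    have hdist := dist_worldLine_lt_of_radial X ω r ha hU hb hgeom
    have hrT : (r : ℝ) < T := lt_of_le_of_lt (NNReal.coe_le_coe.2 hr) hτT
    refine fkWeight_eq_zero_of_dist_lt hcore L X ω hij r.coe_nonneg hrT ?_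
    rw [Real.toNNReal_coe]
    exact hdist
  -- the probabilities
  have hc1 : ∑ p, (fun p => -c p) p ^ 2 = 1 := by
    simp only [neg_sq, hc]
    exact sum_sq_radialCoeff hij hy0
  have hP1 : wienerPaths N E₁ ≤ ENNReal.ofReal (2 * Real.sqrt (θ / Real.sqrt τ)) :=
    measure_forall_coordComb_lt_le (fun p => -c p) hc1 hτ hθ hθτ
  have hPA : preWienerMeasure A ≤ ENNReal.ofReal (2 * (τ : ℝ) ^ 2 / (c' ^ 2 - τ) ^ 2) :=
    measure_exists_le_abs_brownian_le τ hc'.le hτc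
  have hP2 : ∀ m l, wienerPaths N (E₂ m l) ≤
      ENNReal.ofReal (2 * (τ : ℝ) ^ 2 / (c' ^ 2 - τ) ^ 2) := fun m l =>
    calc wienerPaths N (E₂ m l)
        ≤ (wienerPaths N).map (fun ω : PathSpace N => ω m l) A :=
          Measure.le_map_apply (measurePreserving_apply₂ m l).measurable.aemeasurable _
      _ = preWienerMeasure A := by rw [(measurePreserving_apply₂ m l).map_eq]
      _ ≤ _ := hPA
  calc fkSemigroup v L T (fun _ => (1 : ℝ≥0∞)) X
      ≤ wienerPaths N (E₁ ∪ ((⋃ l, E₂ i l) ∪ ⋃ l, E₂ j l)) :=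
        fkSemigroup_one_le_measure v L T X hkill
    _ ≤ wienerPaths N E₁ + (wienerPaths N (⋃ l, E₂ i l) + wienerPaths N (⋃ l, E₂ j l)) :=
        (measure_union_le _ _).trans (add_le_add le_rfl (measure_union_le _ _))
    _ ≤ wienerPaths N E₁ + (∑ l, wienerPaths N (E₂ i l) + ∑ l, wienerPaths N (E₂ j l)) := by
        gcongr <;> exact measure_iUnion_fintype_le _ _
    _ ≤ ENNReal.ofReal (2 * Real.sqrt (θ / Real.sqrt τ)) +
          (∑ _l : Fin 3, ENNReal.ofReal (2 * (τ : ℝ) ^ 2 / (c' ^ 2 - τ) ^ 2) +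
            ∑ _l : Fin 3, ENNReal.ofReal (2 * (τ : ℝ) ^ 2 / (c' ^ 2 - τ) ^ 2)) := by
        exact add_le_add hP1 (add_le_add (Finset.sum_le_sum fun l _ => hP2 i l)
          (Finset.sum_le_sum fun l _ => hP2 j l))
    _ = _ := by
        simp only [Finset.sum_const, Finset.card_univ, Fintype.card_fin, nsmul_eq_mul,
          Nat.cast_ofNat]
        ring

end Summit.AtomisticToContinuum.BoseEinsteinCondensation.Theorems.CutLineWitness
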